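import Mathlib
import Literature.Analysis.FluidPDE.SelfSimilar
import Literature.Analysis.FluidPDE.AxisymmetricEuler
import Literature.Analysis.FluidPDE.TypeIAncientMild
import Literature.Analysis.FluidPDE.PineauVicolRSS
import Literature.Analysis.FluidPDE.OseenZoomCovariance
import Literature.Analysis.FluidPDE.OseenMildUniqueness
import Literature.Analysis.FluidPDE.PineauVicolRDSSLeray
import Literature.Analysis.FluidPDE.PineauVicolRSSChaeWolf
import Literature.Analysis.FluidPDE.PineauVicolRSSProofs
import Summits.NavierStokesRegularity.NavierStokesRegularity.Theorems.QuantisedSymmetryPolyhedralDssProfileExistsStubAncientMildOfClassicalTypeI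
import Summits.NavierStokesRegularity.NavierStokesRegularity.Theorems.DssFarFieldSlavingBlowupTypeIDssProfileSmoothRepresentativeAe
import Summits.NavierStokesRegularity.NavierStokesRegularity.Theorems.DssFarFieldSlavingBlowupTypeIDssProfileAxisymmetricEmpty
import Summits.NavierStokesRegularity.NavierStokesRegularity.Theorems.DssFarFieldSlavingBlowupTypeIDssProfileMirrorCorotating
import Summits.NavierStokesRegularity.NavierStokesRegularity.Theorems.CorkscrewDynamoCorkscrewProfileAngleTools
import Summits.NavierStokesRegularity.NavierStokesRegularity.Theorems.DssFarFieldSlavingBlowupTypeIDssProfileRotatingMirror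
import HarnessLib
import Summits.NavierStokesRegularity.NavierStokesRegularity.Theorems.DssFarFieldSlavingBlowupTypeIDssProfileTiltedIsotropyCalculus

/-!
# T23 — a TILTED (non-commuting) co-rotating isotropy is EMPTY: rotated-(D)SS Type-I ancient mild fields
  whose co-rotating profile has a linear isometry `h` NOT commuting with the frame rotation are trivial
  (route `DssFarFieldSlaving`, crux `BlowupTypeIDssProfile`, stmt-NavierStokesRegularity-0155 — SUPPORT;
  cell pub-ns-dss theory seat g3; subsumes T22/T22′ (reversing `h`) and covers tilted axes)

HONEST FRAMING. A Liouville-type exclusion of ONE family of symmetry cells of the rotated-DSS census class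
of `FilamentSkeletonRss.RdssProfileTruncation`; no claim about Navier–Stokes regularity or blow-up, no
number. Statements and proofs: theory seat g3 (`HOME/theory/TiltedIsotropyEmptyTree.lean`, sha256[16]
9336f5e07602b3c1); the typer split the file for the 400-line cap (part 1 = the rotation calculus,
`…Theorems.DssFarFieldSlavingBlowupTypeIDssProfileTiltedIsotropyCalculus`), wrote the co-rotated isometry
`R_φ h R_{−φ}` out as `((rotZLIE (−φ)).trans h).trans (rotZLIE φ)` (as in the landed T22′ file
`…Theorems.RotatingMirror`, p332886, whose `equivariant_of_le`, `rotMirror_apply`,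
`pvAnsatz_rotMirror_equivariant`, `hasTypeIDecay_pvAnsatz_of_profile` are used) and unfolded the sketch's
`def NoncommutingCorotatingRssLiouville` into the theorem of that name — nothing else.

THEOREM `corotatingIsotropy_trivial` (Oseen gauge). Let `V` be a Type-I ancient mild field (KNSS gauge)
with Type-I space–time decay, `α ≠ 0`, and `h` a linear isometry of `(EuclideanSpace ℝ (Fin 3))` that does NOT commute with the
rotations about the axis (`∃ φ y, h (R_φ y) ≠ R_φ (h y)`; e.g. any rotation-reversing `h` — mirrors in
vertical planes, `C₂` about horizontal axes — and any `h` with `h e₃ ≠ ±e₃`: tilted rotation axes,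
oblique mirrors). If the slice at log-time `s = −log(−t)` is equivariant under the co-rotated copy
`R_{αs} h R_{−αs}` for every `t < 0`, then `V ≡ 0` on `t < 0`.

PROOF (Lie algebra of the isotropy orbit; no classification of closed subgroups of `O(3)` is used).
(1) `equivariant_of_le` (symmetries propagate forward, KNSS §4 uniqueness) upgrades the hypothesis to:
every slice `W = V(t)` is equivariant under `R_θ h R_{−θ}` for EVERY `θ ∈ ℝ` (`conjOrbit_isotropy`:
the angles `α s₀`, `s₀ ≤ s`, fill a half-line, and `R` is `2π`-periodic).
(2) Differentiating `W(R_θ h R_{−θ} y) = R_θ h R_{−θ} W(y)` in `θ` (`fderiv_conjOrbit`, chain rule +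
uniqueness of derivatives; slices are `C^∞`) gives the infinitesimal symmetry
`DW(z)[N_θ z] = N_θ W(z)`, `N_θ = J − R_θ P R_{−θ}`, `P = hJh⁻¹`, `J` = generator of `R`.
(3) The polynomial identity `P + R_π P R_{−π} = 2cJ`, `c = ⟪P e₀, e₁⟫` (`conj_rotGen_add_pi`, valid for
every isometry `h`; proved in the frame `h⁻¹(e₀,e₁,e₂)`) gives `N_0 + N_π = 2(1 − c) J`, so for `c ≠ 1`
the generator `J` itself is an infinitesimal symmetry: `DW(z)[Jz] = J W(z)`.
(4) `c = 1` forces `h` to commute with all `R_φ` (`commute_rotZ_of_coeff_eq_one`: the frame is then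
`(a, Ja, ±e₃)` with `a` horizontal — a sum-of-squares identity), contradicting the hypothesis.
(5) `DW[Jz] = JW` integrates to axisymmetry (`isAxisymmetric_of_fderiv_rotGen`: `θ ↦ R_{−θ} W(R_θ y)`
has zero derivative), and KNSS 2009 Thm 5.3 (`typeI_ancient_axisymmetric_ae_zero`) kills axisymmetric
Type-I ancient mild fields.

COROLLARIES. `corotatingIsotropy_rdss_trivial`: `V = pvAnsatz α W` (Pineau–Vicol (1.13a); co-rotating
profile `W(y, s)` with arbitrary `s`-dependence — RDSS when `2 log c`-periodic, RSS when constant) with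
`W(·, s)` `h`-equivariant for every `s`: `W = 0`. `noncommutingCorotating_trivial` /
`noncommutingCorotatingRssLiouville` (the statement T23 of LIOUVILLE-SIDE.md §8 / sketch §5i, RSS,
`s`-independent profile `U`): `U = 0`. Class level `rdssClass_corotatingIsotropy_empty`; window-classical
RDSS form `corotatingIsotropy_rdss_liouville` (Pineau–Vicol 2026 Thm 1.7's setting).

CENSUS READING. In the co-rotating frame of a rotated-(D)SS profile with angular speed `α ≠ 0`, the
spatial isotropy group `Iso(U) ≤ O(3)` must lie inside the centraliser of the frame rotation,
`{g ∈ O(3) : g R_φ = R_φ g ∀φ} = {R_ψ} ∪ {R_ψ σ_h} ∪ {R_ψ (−1)} ∪ …` = the UNIAXIAL groups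
`C_n, C_nh, S_2n, C_∞…` about the rotation axis; every cell of the K1/K4 isotropy lists whose group
contains a vertical mirror, a horizontal `C₂`-axis, or ANY element moving the axis `e₃` (tilted `C_n`,
polyhedral `T, O, I` and their extensions, `D_n, C_nv, D_nh, D_nd`) is THEOREM-EMPTY at every `α ≠ 0`.
What remains at `α ≠ 0`: `Iso(U) ∈ {C_n, C_nh, S_2n}` co-rotating (and trivial isotropy). NOT covered:
the non-rotating frame `α = 0` (plain DSS: open except the cells emptied by T13/E4/PV(i)/K0d).
PRINTED SKELETON / NOVELTY (lit g2, LIT-COVERAGE §9). The equivariant-dynamics principle behind steps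
(1)–(3) is Golubitsky–Stewart 2002, Ch. 6 Lemma 6.3 (the drift of a relative equilibrium / relative
periodic orbit with isotropy `Σ` lies in the normaliser `N(Σ)`; infinitesimally `Ad_h ξ − ξ ∈ Lie Σ_x`,
which is exactly `N_A ∈ 𝔨` of step (2)) with Thm 6.4 and Example 6.6 (`O(2)`, `ℤ₂`), and Ch. 1
Thm 1.17 / Prop 1.18 (isotropy is
non-decreasing along trajectories = `equivariant_of_le`, forward half, with KNSS §4 forward uniqueness in
place of the ODE flow). The Navier–Stokes statement here is STRONGER in conclusion (`V ≡ 0`, via KNSS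
Thm 5.3, not merely a constraint on the drift) and needs no genericity, normal hyperbolicity or
finite-dimensional reduction; the closed-subgroup classification of `O(3)` (GSS II Ch. XIII Thms 6.1, 9.2)
is NOT used — the dichotomy `c = 1` / `c ≠ 1` replaces it.
[cite: KochNadirashviliSereginSverak2009, §4 and Thm 5.3 (arXiv:0709.3599)]
[cite: PineauVicol2026, (1.13a) and Theorem 1.7 (arXiv:2607.09619 p. 7)]
[cite: GolubitskyStewart2002, Ch. 1 Thm 1.17/Prop 1.18; Ch. 6 Lemma 6.3, Thm 6.4, Ex. 6.6]
[cite: GolubitskyStewartSchaeffer1988, Ch. XIII Thm 6.1 and Thm 9.2 (context only)]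
-/

noncomputable section

set_option linter.dupNamespace false

namespace Summit.NavierStokesRegularity.NavierStokesRegularity.Theorems.TiltedIsotropy

open MeasureTheory Set Function Filter Metric WithLp
open Literature.Analysis.FluidPDE
open Summit.NavierStokesRegularity.NavierStokesRegularity.Theorems
open scoped Topology RealInnerProductSpace

/-! ### Small helpers (private in `…Theorems.RotatingMirror`, re-proved here) -/

/-- `rotZ θ` is continuous (via the bundled `rotZL θ`). -/
private theorem continuous_rotZ_map' (θ : ℝ) : Continuous (rotZ θ : (EuclideanSpace ℝ (Fin 3)) → (EuclideanSpace ℝ (Fin 3))) := by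
  have : (rotZ θ : (EuclideanSpace ℝ (Fin 3)) → (EuclideanSpace ℝ (Fin 3))) = rotZL θ := by funext x; rw [rotZL_apply]
  rw [this]; exact (rotZL θ).continuous

/-- `rotZ θ 0 = 0` (private copy, as in part 1). -/
@[simp] private theorem rotZ_zero_vec (θ : ℝ) : rotZ θ (0 : (EuclideanSpace ℝ (Fin 3))) = 0 := by
  rw [← rotZL_apply, map_zero]

/-- Slices of a Type-I ancient mild field are continuous (public: reused by part 3). -/
theorem slice_continuous {C₀ : ℝ} {V : ℝ → (EuclideanSpace ℝ (Fin 3)) → (EuclideanSpace ℝ (Fin 3))} (hV : IsTypeIAncientMild C₀ V)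
    {t : ℝ} (ht : t < 0) : Continuous (V t) := by
  have h : ContinuousOn (uncurry V ∘ fun x : (EuclideanSpace ℝ (Fin 3)) => (t, x)) univ :=
    hV.1.continuousOn.comp (continuous_const.prodMk continuous_id).continuousOn
      fun x _ => ⟨ht, mem_univ _⟩
  exact (continuousOn_univ.1 h).congr fun x => rfl

/-! ### The co-rotated isometry `R_φ h R_{−φ} = ((rotZLIE (−φ)).trans h).trans (rotZLIE φ)` (as in
`…Theorems.RotatingMirror`: `rotMirror_apply`, `rotMirror_symm_apply` there) -/

/-- `2π`-periodicity of the co-rotated copy. -/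
theorem rotMirror_add_int_mul_two_pi (g : (EuclideanSpace ℝ (Fin 3)) ≃ₗᵢ[ℝ] (EuclideanSpace ℝ (Fin 3))) (θ : ℝ) (k : ℤ) (x : (EuclideanSpace ℝ (Fin 3))) :
    (((rotZLIE (-(θ + k * (2 * Real.pi)))).trans g).trans (rotZLIE (θ + k * (2 * Real.pi)))) x = (((rotZLIE (-θ)).trans g).trans (rotZLIE θ)) x := by
  rw [RotatingMirror.rotMirror_apply, RotatingMirror.rotMirror_apply, CorkscrewProfile.Birth.rotZ_add_int_mul_two_pi,
    show -(θ + (k : ℝ) * (2 * Real.pi)) = -θ + ((-k : ℤ) : ℝ) * (2 * Real.pi) by push_cast; ring,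
    CorkscrewProfile.Birth.rotZ_add_int_mul_two_pi]

/-- Slices of a Type-I ancient mild field are differentiable (indeed `C^∞`). -/
theorem slice_differentiable {C₀ : ℝ} {V : ℝ → (EuclideanSpace ℝ (Fin 3)) → (EuclideanSpace ℝ (Fin 3))} (hV : IsTypeIAncientMild C₀ V)
    {t : ℝ} (ht : t < 0) : Differentiable ℝ (V t) := by
  intro x
  have hopen : IsOpen ((Iio (0 : ℝ)) ×ˢ (univ : Set (EuclideanSpace ℝ (Fin 3)))) := isOpen_Iio.prod isOpen_univ
  have hd : DifferentiableAt ℝ (uncurry V) (t, x) :=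
    (hV.1.differentiableOn (by simp)).differentiableAt (hopen.mem_nhds ⟨ht, mem_univ _⟩)
  exact hd.comp x ((differentiableAt_const t).prodMk differentiableAt_id)

/-! ### Step (1): the isotropy of every slice contains the whole conjugation orbit of `h` -/

/-- If the slice at log-time `s` of a Type-I ancient mild field is `R_{αs} h R_{−αs}`-equivariant for
every `t < 0` (`α ≠ 0`), then every slice is `R_θ h R_{−θ}`-equivariant for EVERY `θ`: propagate the
symmetry of the slice at `s₀ = (θ + 2πk)/α ≤ s` forward (`equivariant_of_le`) and use `2π`-periodicity. -/
theorem conjOrbit_isotropy {C₀ α : ℝ} (hα : α ≠ 0) (h : (EuclideanSpace ℝ (Fin 3)) ≃ₗᵢ[ℝ] (EuclideanSpace ℝ (Fin 3))) {V : ℝ → (EuclideanSpace ℝ (Fin 3)) → (EuclideanSpace ℝ (Fin 3))}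
    (hV : IsTypeIAncientMild C₀ V)
    (hsym : ∀ t < 0, ∀ x, V t ((((rotZLIE (-(α * -Real.log (-t)))).trans h).trans (rotZLIE (α * -Real.log (-t)))) x) =
      (((rotZLIE (-(α * -Real.log (-t)))).trans h).trans (rotZLIE (α * -Real.log (-t)))) (V t x)) :
    ∀ t < 0, ∀ (θ : ℝ) (x : (EuclideanSpace ℝ (Fin 3))), V t ((((rotZLIE (-θ)).trans h).trans (rotZLIE θ)) x) = (((rotZLIE (-θ)).trans h).trans (rotZLIE θ)) (V t x) := by
  intro t ht θ x
  set s : ℝ := -Real.log (-t) with hs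
  -- an integer `k` with `s₀ := (θ + 2πk)/α ≤ s`
  obtain ⟨k, hk⟩ : ∃ k : ℤ, (θ + k * (2 * Real.pi)) / α ≤ s := by
    have h2π : 0 < 2 * Real.pi := by positivity
    rcases lt_or_gt_of_ne hα with hneg | hpos
    · refine ⟨⌈(α * s - θ) / (2 * Real.pi)⌉, ?_⟩
      rw [div_le_iff_of_neg hneg]
      have h1 : (α * s - θ) / (2 * Real.pi) ≤ ⌈(α * s - θ) / (2 * Real.pi)⌉ := Int.le_ceil _
      rw [div_le_iff₀ h2π] at h1
      linarith
    · refine ⟨⌊(α * s - θ) / (2 * Real.pi)⌋, ?_⟩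
      rw [div_le_iff₀ hpos]
      have h1 : (⌊(α * s - θ) / (2 * Real.pi)⌋ : ℝ) ≤ (α * s - θ) / (2 * Real.pi) := Int.floor_le _
      rw [le_div_iff₀ h2π] at h1
      linarith
  set s₀ : ℝ := (θ + k * (2 * Real.pi)) / α with hs₀
  set t₀ : ℝ := -Real.exp (-s₀) with ht₀
  have ht₀neg : t₀ < 0 := neg_neg_of_pos (Real.exp_pos _)
  have hlog₀ : -Real.log (-t₀) = s₀ := by rw [ht₀, neg_neg, Real.log_exp, neg_neg]
  have ht₀t : t₀ ≤ t := by
    have hts : t = -Real.exp (-s) := by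
      rw [hs, neg_neg, Real.exp_log (by linarith), neg_neg]
    rw [hts, ht₀, neg_le_neg_iff]
    exact Real.exp_le_exp.2 (by linarith)
  have hprop := RotatingMirror.equivariant_of_le hV ((((rotZLIE (-(α * s₀))).trans h).trans (rotZLIE (α * s₀)))) ht₀neg
    (fun x => by have := hsym t₀ ht₀neg x; rw [hlog₀] at this; exact this) t ht₀t ht x
  have hαs₀ : α * s₀ = θ + k * (2 * Real.pi) := by
    rw [hs₀]; field_simp
  rw [hαs₀, rotMirror_add_int_mul_two_pi, rotMirror_add_int_mul_two_pi] at hprop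
  exact hprop

/-! ### Steps (2)–(5): the orbit forces axisymmetry; KNSS -/

/-- **T23 (Oseen gauge): a non-commuting isotropy cannot co-rotate.** -/
theorem corotatingIsotropy_trivial {C₀ α : ℝ} (hα : α ≠ 0) {h : (EuclideanSpace ℝ (Fin 3)) ≃ₗᵢ[ℝ] (EuclideanSpace ℝ (Fin 3))}
    (hh : ∃ (φ : ℝ) (y : (EuclideanSpace ℝ (Fin 3))), h (rotZ φ y) ≠ rotZ φ (h y))
    {V : ℝ → (EuclideanSpace ℝ (Fin 3)) → (EuclideanSpace ℝ (Fin 3))} (hV : IsTypeIAncientMild C₀ V) (hdec : HasTypeIDecay C₀ V)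
    (hsym : ∀ t < 0, ∀ x, V t ((((rotZLIE (-(α * -Real.log (-t)))).trans h).trans (rotZLIE (α * -Real.log (-t)))) x) =
      (((rotZLIE (-(α * -Real.log (-t)))).trans h).trans (rotZLIE (α * -Real.log (-t)))) (V t x)) :
    ∀ t < 0, ∀ x, V t x = 0 := by
  -- the coefficient `c = ⟪hJh⁻¹ e₀, e₁⟫` is not `1`
  have hc1 : h (rotGen (h.symm (EuclideanSpace.single 0 (1 : ℝ)))) 1 ≠ 1 := by
    intro hc
    obtain ⟨φ, y, hne⟩ := hh
    exact hne (commute_rotZ_of_coeff_eq_one h hc φ y)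
  have horbit := conjOrbit_isotropy hα h hV hsym
  have hVc : ∀ t < 0, Continuous (V t) := fun t ht => slice_continuous hV ht
  -- every slice is axisymmetric
  have hVax : ∀ t < 0, IsAxisymmetric (V t) := by
    intro t ht
    have hWd : Differentiable ℝ (V t) := slice_differentiable hV ht
    have hB : ∀ (θ : ℝ) (y : (EuclideanSpace ℝ (Fin 3))), V t (rotZ θ (h (rotZ (-θ) y))) = rotZ θ (h (rotZ (-θ) (V t y))) :=
      fun θ y => horbit t ht θ y
    refine isAxisymmetric_of_fderiv_rotGen hWd fun z => ?_
    have h0 := fderiv_conjOrbit hWd h hB 0 z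
    have hπ := fderiv_conjOrbit hWd h hB Real.pi z
    simp only [neg_zero, rotZ_zero] at h0
    set c : ℝ := h (rotGen (h.symm (EuclideanSpace.single 0 (1 : ℝ)))) 1 with hc
    have hPz := conj_rotGen_add_pi h z
    have hPW := conj_rotGen_add_pi h (V t z)
    have hadd : fderiv ℝ (V t) z ((rotGen z - h (rotGen (h.symm z))) +
        (rotGen z - rotZ Real.pi (h (rotGen (h.symm (rotZ (-Real.pi) z)))))) =
        (rotGen (V t z) - h (rotGen (h.symm (V t z)))) +
        (rotGen (V t z) - rotZ Real.pi (h (rotGen (h.symm (rotZ (-Real.pi) (V t z)))))) := by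
      rw [map_add, h0, hπ]
    have lhs_eq : (rotGen z - h (rotGen (h.symm z))) +
        (rotGen z - rotZ Real.pi (h (rotGen (h.symm (rotZ (-Real.pi) z))))) = (2 - 2 * c) • rotGen z := by
      rw [sub_add_sub_comm, hPz, ← two_smul ℝ (rotGen z), ← sub_smul]
    have rhs_eq : (rotGen (V t z) - h (rotGen (h.symm (V t z)))) +
        (rotGen (V t z) - rotZ Real.pi (h (rotGen (h.symm (rotZ (-Real.pi) (V t z)))))) =
        (2 - 2 * c) • rotGen (V t z) := by
      rw [sub_add_sub_comm, hPW, ← two_smul ℝ (rotGen (V t z)), ← sub_smul]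
    rw [lhs_eq, rhs_eq, map_smul] at hadd
    have hne : (2 : ℝ) - 2 * c ≠ 0 := by
      intro h0'
      exact hc1 (by linarith)
    exact smul_right_injective (EuclideanSpace ℝ (Fin 3)) hne hadd
  -- KNSS
  have hVmeas : ∀ t < 0, AEStronglyMeasurable (V t) volume := fun t ht =>
    (hVc t ht).aestronglyMeasurable
  intro t ht x
  have hz := typeI_ancient_axisymmetric_ae_zero hV.isAncientMildSolution hVmeas hdec hVax t ht
  have hV0 : V t = 0 := Measure.eq_of_ae_eq hz (hVc t ht) continuous_const
  exact congrFun hV0 x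

/-! ### Co-rotating profiles -/

/-- **T23 for co-rotating profiles (RDSS / RSS).** A Type-I ancient mild field `pvAnsatz α W`
(co-rotating profile `W(y, s)`, arbitrary `s`-dependence), `α ≠ 0`, with every `W(·, s)` equivariant under
a fixed linear isometry `h` that does not commute with the rotations about the axis, is trivial. -/
theorem corotatingIsotropy_rdss_trivial {C₀ α : ℝ} (hα : α ≠ 0) {h : (EuclideanSpace ℝ (Fin 3)) ≃ₗᵢ[ℝ] (EuclideanSpace ℝ (Fin 3))}
    (hh : ∃ (φ : ℝ) (y : (EuclideanSpace ℝ (Fin 3))), h (rotZ φ y) ≠ rotZ φ (h y))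
    {V : ℝ → (EuclideanSpace ℝ (Fin 3)) → (EuclideanSpace ℝ (Fin 3))} (hV : IsTypeIAncientMild C₀ V) (hdec : HasTypeIDecay C₀ V)
    {W : (EuclideanSpace ℝ (Fin 3)) → ℝ → (EuclideanSpace ℝ (Fin 3))} (hHW : ∀ y s, W (h y) s = h (W y s))
    (hans : ∀ t < 0, ∀ x, V t x = pvAnsatz α W t x) : W = 0 := by
  have hsym : ∀ t < 0, ∀ x, V t ((((rotZLIE (-(α * -Real.log (-t)))).trans h).trans (rotZLIE (α * -Real.log (-t)))) x) =
      (((rotZLIE (-(α * -Real.log (-t)))).trans h).trans (rotZLIE (α * -Real.log (-t)))) (V t x) := by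
    intro t ht x
    rw [hans t ht, hans t ht]
    exact RotatingMirror.pvAnsatz_rotMirror_equivariant hHW t x
  have hzero := corotatingIsotropy_trivial hα hh hV hdec hsym
  funext y s
  set t : ℝ := -Real.exp (-s) with ht
  have htneg : t < 0 := neg_neg_of_pos (Real.exp_pos _)
  have hlog : -Real.log (-t) = s := by rw [ht, neg_neg, Real.log_exp, neg_neg]
  have hsq : 0 < Real.sqrt (-t) := Real.sqrt_pos.2 (by linarith)
  have h1 := hzero t htneg (Real.sqrt (-t) • rotZ (α * s) y)
  rw [hans t htneg] at h1
  simp only [pvAnsatz, hlog, smul_smul, inv_mul_cancel₀ hsq.ne', one_smul,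
    ← rotZ_add, neg_add_cancel, rotZ_zero] at h1
  have h2 : rotZ (α * s) (W y s) = 0 := by
    rcases smul_eq_zero.1 h1 with h0 | h0
    · exact absurd h0 (inv_ne_zero hsq.ne')
    · exact h0
  have h3 := congrArg (rotZ (-(α * s))) h2
  rw [← rotZ_add, neg_add_cancel, rotZ_zero, rotZ_zero_vec] at h3
  exact h3

/-- **T23 (RSS, `s`-independent co-rotating profile)** — the special case `W y s = U y`. -/
theorem noncommutingCorotating_trivial {C₀ α : ℝ} (hα : α ≠ 0) {h : (EuclideanSpace ℝ (Fin 3)) ≃ₗᵢ[ℝ] (EuclideanSpace ℝ (Fin 3))}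
    (hh : ∃ (φ : ℝ) (y : (EuclideanSpace ℝ (Fin 3))), h (rotZ φ y) ≠ rotZ φ (h y))
    {V : ℝ → (EuclideanSpace ℝ (Fin 3)) → (EuclideanSpace ℝ (Fin 3))} (hV : IsTypeIAncientMild C₀ V) (hdec : HasTypeIDecay C₀ V)
    {U : (EuclideanSpace ℝ (Fin 3)) → (EuclideanSpace ℝ (Fin 3))} (hHU : ∀ y, U (h y) = h (U y))
    (hans : ∀ t < 0, ∀ x, V t x = pvAnsatz α (fun y _ => U y) t x) : U = 0 := by
  have h1 := corotatingIsotropy_rdss_trivial hα hh hV hdec (W := fun y _ => U y) (fun y _ => hHU y) hans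
  funext y
  exact congrFun (congrFun h1 y) 0

/-- **T23 = `NoncommutingCorotatingRssLiouville` of the theory seat (LIOUVILLE-SIDE.md §8, sketch §5i),
statement verbatim with the sketch's `def` unfolded**: for every Type-I constant `C₀` and angular speed
`α ≠ 0`, every linear isometry `h` NOT commuting with the rotations about the axis, every Type-I ancient
mild `V` with Type-I decay of the rotating self-similar form `pvAnsatz α U` whose profile `U` is
`h`-equivariant: `U = 0`. -/
theorem noncommutingCorotatingRssLiouville :
    ∀ (C₀ α : ℝ), α ≠ 0 → ∀ (h : (EuclideanSpace ℝ (Fin 3)) ≃ₗᵢ[ℝ] (EuclideanSpace ℝ (Fin 3))), (∃ (φ : ℝ) (y : (EuclideanSpace ℝ (Fin 3))), h (rotZ φ y) ≠ rotZ φ (h y)) →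
      ∀ (V : ℝ → (EuclideanSpace ℝ (Fin 3)) → (EuclideanSpace ℝ (Fin 3))) (U : (EuclideanSpace ℝ (Fin 3)) → (EuclideanSpace ℝ (Fin 3))), IsTypeIAncientMild C₀ V → HasTypeIDecay C₀ V →
        (∀ y, U (h y) = h (U y)) → (∀ t < 0, ∀ x, V t x = pvAnsatz α (fun y _ => U y) t x) → U = 0 :=
  fun _C₀ _α hα _h hh _V _U hV hdec hHU hans => noncommutingCorotating_trivial hα hh hV hdec hHU hans

/-! ### Class level and the window-classical (Pineau–Vicol Thm 1.7) phrasing -/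

/-- **T23 at CLASS level.** A member of the census class (ancient mild, measurable slices, Type-I `M`)
that is a co-rotating field `pvAnsatz α W` (`α ≠ 0`) with continuous profile slices `W(·, s)`, each
equivariant under a fixed non-commuting linear isometry `h`, has `W = 0`. -/
theorem rdssClass_corotatingIsotropy_empty {M α : ℝ} (hα : α ≠ 0) {h : (EuclideanSpace ℝ (Fin 3)) ≃ₗᵢ[ℝ] (EuclideanSpace ℝ (Fin 3))}
    (hh : ∃ (φ : ℝ) (y : (EuclideanSpace ℝ (Fin 3))), h (rotZ φ y) ≠ rotZ φ (h y)) {W : (EuclideanSpace ℝ (Fin 3)) → ℝ → (EuclideanSpace ℝ (Fin 3))}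
    (hW : ∀ s, Continuous fun y => W y s) (hHW : ∀ y s, W (h y) s = h (W y s))
    {u : ℝ → (EuclideanSpace ℝ (Fin 3)) → (EuclideanSpace ℝ (Fin 3))} (hmild : IsAncientMildSolution 1 u)
    (hmeas : ∀ t < 0, AEStronglyMeasurable (u t) volume) (hdec : HasTypeIDecay M u)
    (hans : ∀ t < 0, ∀ x, u t x = pvAnsatz α W t x) : W = 0 := by
  obtain ⟨V, hT, hVdec, hVu, -⟩ := typeI_ancient_smoothRepresentative_ae hmild hmeas hdec
  have hVc : ∀ t < 0, Continuous (V t) := fun t ht => slice_continuous hT ht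
  have huc : ∀ t < 0, Continuous (u t) := fun t ht => by
    have : u t = fun x => pvAnsatz α W t x := funext (hans t ht)
    rw [this]
    exact ((continuous_rotZ_map' _).comp ((hW _).comp ((continuous_rotZ_map' _).comp
      (continuous_const_smul ((Real.sqrt (-t))⁻¹ : ℝ))))).const_smul ((Real.sqrt (-t))⁻¹ : ℝ)
  have hVeq : ∀ t < 0, V t = u t := fun t ht => Measure.eq_of_ae_eq (hVu t ht) (hVc t ht) (huc t ht)
  exact corotatingIsotropy_rdss_trivial hα hh hT hVdec hHW fun t ht x => by
    rw [hVeq t ht]; exact hans t ht x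

/-- **T23 in the window-classical phrasing of Pineau–Vicol 2026 Thm 1.7's setting (RDSS).** A classical
solution on `(EuclideanSpace ℝ (Fin 3)) × [−1, 0)` with the Type-I bound (1.10), backwards rotated DSS in the form (1.13a) with
angular speed `α ≠ 0`, factor `c > 1` and a `2 log c`-periodic co-rotating profile `W` whose slices are
equivariant under a fixed non-commuting linear isometry `h`, has `W ≡ 0`. -/
theorem corotatingIsotropy_rdss_liouville {C₀ α c : ℝ} (hα : α ≠ 0) (hc : 1 < c) {h : (EuclideanSpace ℝ (Fin 3)) ≃ₗᵢ[ℝ] (EuclideanSpace ℝ (Fin 3))}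
    (hh : ∃ (φ : ℝ) (y : (EuclideanSpace ℝ (Fin 3))), h (rotZ φ y) ≠ rotZ φ (h y)) {u : ℝ → (EuclideanSpace ℝ (Fin 3)) → (EuclideanSpace ℝ (Fin 3))} {p : ℝ → (EuclideanSpace ℝ (Fin 3)) → ℝ}
    {W : (EuclideanSpace ℝ (Fin 3)) → ℝ → (EuclideanSpace ℝ (Fin 3))} (hsol : IsClassicalNSSolutionOn (Ico (-1) 0) 1 0 u p)
    (hI : ∀ t ∈ Ico (-1 : ℝ) 0, ∀ x, ‖u t x‖ ≤ C₀ / (‖x‖ + Real.sqrt (-t)))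
    (hper : ∀ (y : (EuclideanSpace ℝ (Fin 3))) (s : ℝ), W y (s + 2 * Real.log c) = W y s)
    (hHW : ∀ y s, W (h y) s = h (W y s))
    (hans : ∀ t ∈ Ico (-1 : ℝ) 0, ∀ x, u t x = pvAnsatz α W t x) : W = 0 := by
  obtain ⟨P, hP⟩ := PineauVicol2026.exists_isClassicalNSSolutionOn_Iio_of_isRotatedDSS hsol
    hc (PineauVicol2026.isRotatedDSS_pvAnsatz (α := α) (U := W) (lt_trans zero_lt_one hc) hper) hans
  have hprof : ∀ (y : (EuclideanSpace ℝ (Fin 3))) (s : ℝ), ‖W y s‖ ≤ C₀ / (1 + ‖y‖) :=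
    PineauVicol2026.norm_profile_le_of_typeI_periodic hc hI hper hans
  have hIw : HasTypeIDecay C₀ (pvAnsatz α W) := RotatingMirror.hasTypeIDecay_pvAnsatz_of_profile hprof
  exact corotatingIsotropy_rdss_trivial hα hh
    (PolyhedralDssProfileExists.Birth.isTypeIAncientMild_of_classical_typeI hP hIw) hIw hHW
    fun t _ x => rfl

end Summit.NavierStokesRegularity.NavierStokesRegularity.Theorems.TiltedIsotropy

end
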